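import Mathlib
import HarnessLib
import Summits.HubbardSuperconductivity.HubbardSuperconductivity.Theorems.KLProgrammeKLRegimeEngineV17F2ClosersVGQOut
import Summits.HubbardSuperconductivity.HubbardSuperconductivity.Theorems.KLProgrammeKLRegimeEngineV17F2ClosersVGQIso
import Summits.HubbardSuperconductivity.HubbardSuperconductivity.Theorems.KLProgrammeKLRegimeEngineV17F2ClosersVGQLad
import Summits.HubbardSuperconductivity.HubbardSuperconductivity.Theorems.KLProgrammeKLRegimeEnginePairTransferOutClassFrameShiftSizesSucc
import Summits.HubbardSuperconductivity.HubbardSuperconductivity.Theorems.KLProgrammeKLRegimeEnginePairTransferOutClassHoutG14SplitCells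
import Summits.HubbardSuperconductivity.HubbardSuperconductivity.Theorems.KLProgrammeKLRegimeEngineV8PairTransferExport8Shares
import Summits.HubbardSuperconductivity.HubbardSuperconductivity.Theorems.KLProgrammeKLRegimeEngineV17F2ClosersVGQ
import Summits.HubbardSuperconductivity.HubbardSuperconductivity.Theorems.KLProgrammeKLRegimeEngineV17F2ClosersVGQSizeFitsC

/-!
# K3 ENGINE (stmt-HubbardSuperconductivity-20437 `KLRegimeEngineV17F2`, V2), row (c) `stub_engine_step_values`: THE (c)-OUT ∃-PACKAGE IN ANGULAR-CELL FORM (package ζ) —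
# cure (A″) of located «(c)-OUT-COOPER-ANTIPODE» (cell gate-hubbard-kl, seat hubbard-kl-k3c2-p2 g26; sequel of `…ClosersVGQOutD` p718126)

WHY.  Package δ (`rowC_hexOut_of_pkgδ`) books the dressed split's pin `F₁₀` through ONE GLOBAL torus-Lipschitz constant `L₁ ≤ 2¹⁵(Klam U)²` and ONE window — not
dischargeable at deep scales near the Cooper antipode of the external leg (COOPER-ANTIPODE.md).  Package ζ replaces, inside the same ∃-package, (i) `L₁` by a GLOBAL `K_g`
(any size; booked in the lattice share) plus an ANGULAR-CELL family `(Nc, S, αc, βc, Lc, r)` — arcs of ray angles covering `(−π,π)`, serving sets around the flow frame's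
Fermi curve `klFermiPoint μ Kₙ`, cell Lipschitz constants — with the ARC currency `Σ_i Lc_i(β_i − α_i) ≤ 2³⁵(Klam U)²`, (ii) the single window by a FAMILY `(Nw, F₂, Fx₂, cen,
cenx, ρw, A₂)` (cell flatness), (iii) `hShareLat` stated at `K_g`, `hShareRL` absorbing the scale-free defect, `hShareEps` summed over the windows; all other rows as δ.
The head is `outClass_hout_klEngGeo14_of_shares_of_raw_cells` (…OutClassHoutG14SplitCells); the fits come from `rowC_sizeFitsC_klEng14Q9dG_of_currency` (§0).
* §0 `rowC_sizeFitsC_klEng14Q9dG_of_currency`; §1 **`rowC_hexOut_of_pkgζ hexOutPkgζ : hexOut`**.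
Plumbing only; the package is a HYPOTHESIS; nothing here asserts (c), any open row of 20437, K3 or superconductivity.  0 kit · 0 lit.
-/

noncomputable section

namespace Summit.HubbardSuperconductivity.HubbardSuperconductivity.Theorems.EngineV8

set_option linter.dupNamespace false -- summit = problem name (single-conjunct summit), D-0017

open Real Set Finset Complex Matrix Literature.MathematicalPhysics.QuantumLattice GrassmannAlgebra
open Literature.Probability.LatticeModels hiding torusSupNorm
open Literature.MathematicalPhysics.QuantumLattice.BandSectorCounting
open Summit.HubbardSuperconductivity.HubbardSuperconductivity.Theorems.KLProgrammeLegKernels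
open Summit.HubbardSuperconductivity.HubbardSuperconductivity.Theorems.KLRegimeWick
open Summit.HubbardSuperconductivity.HubbardSuperconductivity.Theorems.TwoPointAssembly
open Summit.HubbardSuperconductivity.HubbardSuperconductivity.Theorems.DispersionFlow
open Summit.HubbardSuperconductivity.HubbardSuperconductivity.Theorems.PerturbedFermiCurve
open Summit.HubbardSuperconductivity.HubbardSuperconductivity.Theorems.TwoVolumeDefect
open Summit.HubbardSuperconductivity.HubbardSuperconductivity.Theorems.KLRegimeSplit

/-! ## §0 The size rows of the cells head from the currency rows, at the tokens -/

/-- **Size rows at the V2 tokens, cells head**: from `2‖c₀‖ + A₁ ≤ 2¹⁰(Klam U)²`, `I₁ ≤ 2³⁵(Klam U)²`, `A₀S, LAS ≤ 2²⁴(Klam U)³`: the born-line fit `hTHS`, the cells fits `hZS`,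
`hTH`, `hTHR`, `hTR` (shapes of `outClass_hout_klEngGeo14_of_shares_of_raw_cells` at `j = n+1`, `B.Dtmin = cDtmin(−6/5,−1/10)`), the born share, and the window floor
`7/25 ≤ Dt − 4Af` (for the serving radius). -/
theorem rowC_sizeFitsC_klEng14Q9dG_of_currency {P : SplitConsts} {R : RenConsts} {c U : ℝ}
    (hP : P.WF) (hR : R.WF2) (hc : 0 < c) (hU : 0 < U) (hUle : U ≤ klEngU₀12GQ klEngGeo14 (klEngQ9dG klEngGeo14 P R) P R c)
    (hA20 : 4 * (2 * R.Gfr 0 * |U| + 2 * R.Gfr 1 * U ^ 2 + R.Gfr 2 * (c / Real.log 4)) ≤ 1 / 20)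
    (n : ℕ) {c₀ : ℂ} {A₁ I₁ A₀S LAS : ℝ} (hA1 : 0 ≤ A₁) (hI1 : 0 ≤ I₁) (hA0S : 0 ≤ A₀S) (hLAS : 0 ≤ LAS)
    (hA0 : 2 * ‖c₀‖ + A₁ ≤ 2 ^ 10 * (P.Klam * U) ^ 2) (hI : I₁ ≤ 2 ^ 35 * (P.Klam * U) ^ 2)
    (hS : A₀S ≤ 2 ^ 24 * (P.Klam * U) ^ 3) (hLS : LAS ≤ 2 ^ 24 * (P.Klam * U) ^ 3) :
    ((393216 / Real.pi * (64 * (klScale klE0 (n + 1) / klScale klE0 (n + 1)) ^ 2 + (2 * (448 / 3 * Real.exp 2) + 8) + 64) * (2 * A₀S * (Real.pi * Real.sqrt 2 / (cDtmin (-(6 / 5)) (-(1 / 10)) - 4 * (2 * R.Gfr 0 * |U| + 2 * R.Gfr 1 * U ^ 2 + R.Gfr 2 * (c / Real.log 4)))))) ≤ 2 ^ 77 * (P.Klam * U) ^ 2) ∧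
    (64 / Real.pi * 8 * (Real.pi * Real.sqrt 2 / (cDtmin (-(6 / 5)) (-(1 / 10)) - 4 * (2 * R.Gfr 0 * |U| + 2 * R.Gfr 1 * U ^ 2 + R.Gfr 2 * (c / Real.log 4))) / (cDtmin (-(6 / 5)) (-(1 / 10)) - 4 * (2 * R.Gfr 0 * |U| + 2 * R.Gfr 1 * U ^ 2 + R.Gfr 2 * (c / Real.log 4)))) * (I₁ / (2 * π)) +
      64 / Real.pi * 8 * (Real.pi * Real.sqrt 2 / (cDtmin (-(6 / 5)) (-(1 / 10)) - 4 * (2 * R.Gfr 0 * |U| + 2 * R.Gfr 1 * U ^ 2 + R.Gfr 2 * (c / Real.log 4))) * (2 * (2 * ‖c₀‖ + A₁) * (2 / (1 / 10))) / (cDtmin (-(6 / 5)) (-(1 / 10)) - 4 * (2 * R.Gfr 0 * |U| + 2 * R.Gfr 1 * U ^ 2 + R.Gfr 2 * (c / Real.log 4))) + 2 * (2 * ‖c₀‖ + A₁) * (1 / (cDtmin (-(6 / 5)) (-(1 / 10)) - 4 * (2 * R.Gfr 0 * |U| + 2 * R.Gfr 1 * U ^ 2 + R.Gfr 2 * (c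 / Real.log 4))) ^ 2 + Real.pi * Real.sqrt 2 * (2 + 4 * (2 * R.Gfr 0 * |U| + 2 * R.Gfr 1 * U ^ 2 + R.Gfr 2 * (c / Real.log 4))) / (cDtmin (-(6 / 5)) (-(1 / 10)) - 4 * (2 * R.Gfr 0 * |U| + 2 * R.Gfr 1 * U ^ 2 + R.Gfr 2 * (c / Real.log 4))) ^ 3)) ≤ 2 ^ 52 * (P.Klam * U) ^ 2) ∧
    ((393216 / Real.pi * (64 * (klScale klE0 (n + 1) / klScale klE0 (n + 1)) ^ 2 + (2 * (448 / 3 * Real.exp 2) + 8) + 64) * (2 * (2 * ‖c₀‖ + A₁) * (Real.pi * Real.sqrt 2 / (cDtmin (-(6 / 5)) (-(1 / 10)) - 4 * (2 * R.Gfr 0 * |U| + 2 * R.Gfr 1 * U ^ 2 + R.Gfr 2 * (c / Real.log 4)))))) ≤ 2 ^ 76 * (P.Klam * U) ^ 2) ∧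
    ((393216 / Real.pi * (64 * (klScale klE0 (n + 1) / klScale klE0 (n + 1)) ^ 2 + (2 * (448 / 3 * Real.exp 2) + 8) + 64) * (2 * (2 * ‖c₀‖ + A₁) * (Real.pi * Real.sqrt 2 / (cDtmin (-(6 / 5)) (-(1 / 10)) - 4 * (2 * R.Gfr 0 * |U| + 2 * R.Gfr 1 * U ^ 2 + R.Gfr 2 * (c / Real.log 4)))))) +
      2 * (64 / Real.pi * 8 * (2 * (2 * ‖c₀‖ + A₁) * (Real.pi * Real.sqrt 2 / (cDtmin (-(6 / 5)) (-(1 / 10)) - 4 * (2 * R.Gfr 0 * |U| + 2 * R.Gfr 1 * U ^ 2 + R.Gfr 2 * (c / Real.log 4))))) * (3 * (8 * (16 : ℝ) ^ (n + 1 - (n + 1))) + 512 * 1) +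
      4 * (48 / Real.pi * 8 * (2 * (2 * ‖c₀‖ + A₁) * (Real.pi * Real.sqrt 2 / (cDtmin (-(6 / 5)) (-(1 / 10)) - 4 * (2 * R.Gfr 0 * |U| + 2 * R.Gfr 1 * U ^ 2 + R.Gfr 2 * (c / Real.log 4))))) * (3 * (8 * (16 : ℝ) ^ (n + 1 - (n + 1))) + 512 * 1))) ≤ 2 ^ 76 * (P.Klam * U) ^ 2) ∧
    ((64 / Real.pi * 8 * (2 * (2 * ‖c₀‖ + A₁) * (Real.pi * Real.sqrt 2 / (cDtmin (-(6 / 5)) (-(1 / 10)) - 4 * (2 * R.Gfr 0 * |U| + 2 * R.Gfr 1 * U ^ 2 + R.Gfr 2 * (c / Real.log 4))))) * (3 * (8 * (16 : ℝ) ^ (n + 1 - (n + 1))) + 512 * 1) +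
      4 * (48 / Real.pi * 8 * (2 * (2 * ‖c₀‖ + A₁) * (Real.pi * Real.sqrt 2 / (cDtmin (-(6 / 5)) (-(1 / 10)) - 4 * (2 * R.Gfr 0 * |U| + 2 * R.Gfr 1 * U ^ 2 + R.Gfr 2 * (c / Real.log 4))))) * (3 * (8 * (16 : ℝ) ^ (n + 1 - (n + 1))) + 512 * 1))) * (4 + 8 / 3 * R.Gfr 1 * U ^ 2) ≤ 2 ^ 52 * (P.Klam * U) ^ 2) ∧
    ((524288 / Real.pi * (64 * (klScale klE0 (n + 1) / klScale klE0 (n + 1)) ^ 2 + (2 * (448 / 3 * Real.exp 2) + 8) + 64) * (Real.pi * Real.sqrt 2 / (cDtmin (-(6 / 5)) (-(1 / 10)) - 4 * (2 * R.Gfr 0 * |U| + 2 * R.Gfr 1 * U ^ 2 + R.Gfr 2 * (c / Real.log 4))) * (2 * LAS + 2 * A₀S * (2 / (1 / 10))) / (cDtmin (-(6 / 5)) (-(1 / 10)) - 4 * (2 * R.Gfr 0 * |U| + 2 * R.Gfr 1 * U ^ 2 + R.Gfr 2 * (c / Real.log 4))) + 2 * A₀S * (1 / (cDtmin (-(6 /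 5)) (-(1 / 10)) - 4 * (2 * R.Gfr 0 * |U| + 2 * R.Gfr 1 * U ^ 2 + R.Gfr 2 * (c / Real.log 4))) ^ 2 + Real.pi * Real.sqrt 2 * (2 + 4 * (2 * R.Gfr 0 * |U| + 2 * R.Gfr 1 * U ^ 2 + R.Gfr 2 * (c / Real.log 4))) / (cDtmin (-(6 / 5)) (-(1 / 10)) - 4 * (2 * R.Gfr 0 * |U| + 2 * R.Gfr 1 * U ^ 2 + R.Gfr 2 * (c / Real.log 4))) ^ 3))) * klE0 ≤ 4 * 4⁻¹ * ((klEngQ9dG klEngGeo14 P R).CR * (P.Klam * |U|) ^ 3)) ∧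
    (7 / 25 ≤ cDtmin (-(6 / 5)) (-(1 / 10)) - 4 * (2 * R.Gfr 0 * |U| + 2 * R.Gfr 1 * U ^ 2 + R.Gfr 2 * (c / Real.log 4))) := by
  have hDt := cDtmin_engineWindow_ge
  have hGfr : ∀ j, 0 ≤ R.Gfr j := hR.1.2.2
  have hlog4 : 0 < Real.log 4 := Real.log_pos (by norm_num)
  have hAf0 : 0 ≤ (2 * R.Gfr 0 * |U| + 2 * R.Gfr 1 * U ^ 2 + R.Gfr 2 * (c / Real.log 4)) := by
    have := hGfr 0; have := hGfr 1; have := hGfr 2; positivity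
  obtain ⟨hG₁0, hG₁⟩ := rowC_hGU klEngGeo14 hR hU hUle
  obtain ⟨hKU0, hKU, -⟩ := rowC_klam_mul_le klEngGeo14 hP hU hUle
  have hr : klScale klE0 (n + 1) / klScale klE0 (n + 1) = 1 :=
    div_self (ne_of_gt (by unfold klScale; exact mul_pos klE0_pos (by positivity)))
  have hs : (16 : ℝ) ^ (n + 1 - (n + 1)) = 1 := by rw [Nat.sub_self, pow_zero]
  have hnc : 0 ≤ ‖c₀‖ := norm_nonneg _
  have hP1 : 1 ≤ klEngPsq P := one_le_klEngPsq P
  have hR1 : 1 ≤ klEngRsq R := one_le_klEngRsq R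
  have hPR : 1 ≤ klEngPsq P ^ 2 * klEngRsq R ^ 2 := one_le_mul_of_one_le_of_one_le (one_le_pow₀ hP1) (one_le_pow₀ hR1)
  have hCR : 2 ^ 60 ≤ (klEngQ9dG klEngGeo14 P R).CR := by
    refine le_trans ?_ (rowC_hQCR klEngGeo14 P R)
    have : (2 : ℝ) ^ 60 ≤ 2 ^ 60 * (klEngPsq P ^ 2 * klEngRsq R ^ 2) := le_mul_of_one_le_right (by positivity) hPR
    exact this.trans_eq (by ring)
  have he : klE0 ≤ 1 / 32 := by norm_num [klE0]
  have hK2 : (0 : ℝ) ≤ 2 ^ 15 * (P.Klam * U) ^ 2 := by positivity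
  obtain ⟨h1, -, h3, -, -⟩ := rowC_fits_of_currency hDt hAf0 hA20 hG₁0 hG₁ hr hs hKU hnc hA1 le_rfl hA0S hA0 hK2 hS
  obtain ⟨hz, hthr, htr⟩ := rowC_fitsC_of_currency hDt hAf0 hA20 hG₁0 hG₁ hr hs hnc hA1 hI1 hA0 hI
  obtain ⟨hD1, -, -, -, -⟩ := rowC_window_consts_le hDt hAf0 hA20
  exact ⟨h1, hz, h3, hthr, htr, rowC_shareBorn_of_currency hDt hAf0 hA20 hr hU hKU0 hA0S hLAS hS hLS klE0_pos.le he hCR, hD1⟩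

set_option maxHeartbeats 4000000 in -- ≈ 120 literal binders through the (c)-OUT head + the doors; plumbing only
/-- **ROW (c)'s OUT-OF-CLASS producer `hexOut` FROM ONE ∃-PACKAGE IN ANGULAR-CELL FORM** (package ζ; binder text of package δ with the cell family, the window family, the arc currency and the re-keyed shares — see the module docstring) at the registered tokens `(klEngGeo14, klEngQ9dG klEngGeo14 P R)`:
identical to `rowC_hexOut_of_pkgγ` (…ClosersVGQOutC) EXCEPT that the five numeric FIT rows `hTHS hZS hTH hTHR hTR` and the two size-keyed SHARE rows `hShareLat hShareBorn`
of package γ are REPLACED by the four CURRENCY rows `2‖c₀‖ + A₁ ≤ 2¹⁰(Klam U)²`, `L₁ ≤ 2¹⁵(Klam U)²`, `A₀S ≤ 2²⁴(Klam U)³`, `LAS ≤ 2²⁴(Klam U)³` (natural sizes: `A₀ ~ 2⁵(Klam U)²`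
from `c₄² ≤ 8Klam²`; the self-energy pair is cubic), discharged inside by `rowC_sizeFits_klEng14Q9dG_of_currency` (…ClosersVGQSizeFits) against the row-(c) doors.  What the
package still hands — over the head's abbreviations `A A′ b′ V V6 Sg Hd Φ Wd Br` (∀-bound with their defining equations, instantiate with `rfl`) — is the data
`c₄ RH RL c₀ F₁ F₂ F₁₀ Fx₁ Fx₂ Fx₁₀ A₁ L₁ ε₁ cen cenx ρw A₂ A₀S LAS εS` and the rows: `Z ≠ 0` on `[Λₙ₊₁, Λₙ]` [E1]; «(N₄-PATH)» `‖V j t X‖ ≤ c₄U`, `c₄² ≤ 2³Klam²` [E1];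
the six-leg / loop rows `RH`, `RL` [E1/k3c1] with their shares `hShareHd`, `hShareRL`; the (E4)-DRESSED-SPLIT `hsplit/hsplitX` + pins `(A₁, L₁, ε₁)` + windows
`(cen, cenx, ρw, A₂)` [E1/c4a-1]; the self-energy data `(A₀S, LAS, εS)` [E1]; the four currency rows; the `ε`-share `hShareEps` at `s = ¼`; the class-#5 RELATIVE DATUM in
regime (β) only; and the frame-shift producers' inputs (as in package γ).  EVERYTHING ELSE of `outClass_hout_klEngGeo14_of_shares_of_raw_split3` is DISCHARGED here (doors of
`…ClosersVGQDoors`, the a-priori blocks of p693922, the a-priori pair array, un-smearing, `hsoft`, the klCT8 one-step booking, the erem host, p2's frame-shift producers, and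
now the seven size rows).  The conclusion is EXACTLY the `hexOut` hypothesis of `A24a1G14.stub_engine_step_values_of_producers` (…ClosersVGQ).  Hypotheses, not
assertions; nothing here asserts any row of the package. -/
theorem rowC_hexOut_of_pkgζ
    (hexOutPkg :
      ∀ (P : SplitConsts) (R : RenConsts) (c : ℝ), P.WF → R.WF2 → 0 < c → c ≤ klEngC₃7GU klEngGeo14 P R →
        ∀ μ ∈ klWindowC, ∀ U : ℝ, 0 < U → U ≤ klEngU₀12GQ klEngGeo14 (klEngQ9dG klEngGeo14 P R) P R c → ∀ β : ℝ, klBetaMin ≤ β → β ≤ Real.exp (c / U ^ 2) →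
          ∀ (L M : ℕ) [NeZero L] [NeZero M], klEngL₄ P R β U ≤ L → klEngM₃ β U L ≤ M →
            ∀ n' : ℕ, 1 ≤ n' → n' ≤ nScales β + 1 → IsKLRegime U c (-(n' : ℤ)) →
              HistP klPredsV17F2 L M klEngGeo14 P (klEngQ9dG klEngGeo14 P R) R β U μ 0 n' →
                FrameOK R U (nScales β) μ (klFlowFrameU L M β U μ n') →
                  KernelNormsV4 L M P (klEngQ9dG klEngGeo14 P R) β U μ (klFlowFrameU L M β U μ n') n' →
                    (∀ j ≤ n', (KernelNormsLevels L M P (klEngQ9dG klEngGeo14 P R) β U μ (klFlowFrameU L M β U μ n') j ∧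
                      KernelNormsWt4 L M (klWtBudget P (klEngQ9dG klEngGeo14 P R) U j) β U μ (klFlowFrameU L M β U μ n') j)) →
                      (∀ j ≤ n', LevelsUExportMixedAt L M (klCU2 P R (klEngQ7 P R)) P β U μ j) →
                        (∀ j ≤ n', IsoTupleLineBAt L M klE5AM klE5cM (klE5dM P R) P β U μ j) →
                          (∀ j ≤ n', PairTransferRelFamilyK5 L M klEngGeoTh P (klCT8 P R (klEngQ7 P R) klEngGeo14 klEngGeoTh) β U μ j) →
          ∀ n : ℕ, n' = n + 1 → ∀ Qm : TorusSite 2 L, ¬ IsPairClassAt L Qm (n + 1) → ∀ x ∈ klBall L μ 0, ∀ y ∈ klBall L μ 0,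
            ∀ j : ℕ, j = n + 1 →
            ∀ (A A' : ℕ → TorusSite 2 L → ℝ → Matrix (TorusSite 2 L) (TorusSite 2 L) ℂ) (b' : ℕ → TorusSite 2 L → ℝ → TorusSite 2 L → ℂ),
              (A = fun j Qm t => Matrix.of fun k k' : TorusSite 2 L => if k ∈ klBall L μ 0 ∧ k' ∈ klBall L μ 0 then vertexFn L M β (gaussConv ℂ (softCovOf L M β μ (klFlowFrameU L M β U μ n) (softSymbolCompl L M β μ (klFlowFrameU L M β U μ n) (n + 1) j) + hubbardCovAboveCT L M β μ 0 (klFlowFrameU L M β U μ n) (klScale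
                  klE0 (n + 1)) - hubbardCovAboveCT L M β μ 0 (klFlowFrameU L M β U μ n) (klScale klE0 n + t * (klScale klE0 (n + 1) - klScale klE0 n))) (hubbardEffectiveActionCT L M β U μ 0 (klFlowFrameU L M β U μ n) (klScale klE0 n + t * (klScale klE0 (n + 1) - klScale klE0 n)))) 4 ![(((omega0 M, k'), 0), 0),
                  ((((omega0 M).rev, Qm - k'), 1), 0), ((((omega0 M).rev, Qm - k), 1), 1), (((omega0 M, k), 0), 1)] else 0) →
              (A' = fun j Qm t => Matrix.of fun k k' : TorusSite 2 L => if k ∈ klBall L μ 0 ∧ k' ∈ klBall L μ 0 then (klScale klE0 (n + 1) - klScale klE0 n) • -((2 : ℂ)⁻¹ * vertexFn L M β (gaussConv ℂ (softCovOf L M β μ (klFlowFrameU L M β U μ n) (softSymbolCompl L M β μ (klFlowFrameU L M β U μ n) (n + 1) j) +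
                  hubbardCovAboveCT L M β μ 0 (klFlowFrameU L M β U μ n) (klScale klE0 (n + 1)) - hubbardCovAboveCT L M β μ 0 (klFlowFrameU L M β U μ n) (klScale klE0 n + t * (klScale klE0 (n + 1) - klScale klE0 n))) (grassmannDerivPairing ℂ (Matrix.of fun X Y : HubbardFieldIdx L M => deriv (fun Λ'' : ℝ =>
                  hubbardCovAboveCT L M β μ 0 (klFlowFrameU L M β U μ n) Λ'' X Y) (klScale klE0 n + t * (klScale klE0 (n + 1) - klScale klE0 n))) (hubbardEffectiveActionCT L M β U μ 0 (klFlowFrameU L M β U μ n) (klScale klE0 n + t * (klScale klE0 (n + 1) - klScale klE0 n))) (hubbardEffectiveActionCT L M β U μ 0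
                  (klFlowFrameU L M β U μ n) (klScale klE0 n + t * (klScale klE0 (n + 1) - klScale klE0 n))))) 4 ![(((omega0 M, k'), 0), 0), ((((omega0 M).rev, Qm - k'), 1), 0), ((((omega0 M).rev, Qm - k), 1), 1), (((omega0 M, k), 0), 1)]) else 0) →
              (b' = fun (j : ℕ) (Qm : TorusSite 2 L) (t : ℝ) (p : TorusSite 2 L) => (((klScale klE0 (n + 1) - klScale klE0 n) * (klBubbleMass L M β μ (klFlowFrameU L M β U μ n) (fun k => deriv (fun Λ' => hubbardCutoffWeightCT L M β μ (klFlowFrameU L M β U μ n) Λ' k) (klScale klE0 n + t * (klScale klE0 (n + 1) -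
                  klScale klE0 n))) (fun k => (softSymbolCompl L M β μ (klFlowFrameU L M β U μ n) (n + 1) j) k + (hubbardCutoffWeightCT L M β μ (klFlowFrameU L M β U μ n) (klScale klE0 (n + 1)) k - hubbardCutoffWeightCT L M β μ (klFlowFrameU L M β U μ n) (klScale klE0 n + t * (klScale klE0 (n + 1) - klScale klE0 n))
                  k)) Qm p + klBubbleMass L M β μ (klFlowFrameU L M β U μ n) (fun k => (softSymbolCompl L M β μ (klFlowFrameU L M β U μ n) (n + 1) j) k + (hubbardCutoffWeightCT L M β μ (klFlowFrameU L M β U μ n) (klScale klE0 (n + 1)) k - hubbardCutoffWeightCT L M β μ (klFlowFrameU L M β U μ n) (klScale klE0 n + t *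
                  (klScale klE0 (n + 1) - klScale klE0 n)) k)) (fun k => deriv (fun Λ' => hubbardCutoffWeightCT L M β μ (klFlowFrameU L M β U μ n) Λ' k) (klScale klE0 n + t * (klScale klE0 (n + 1) - klScale klE0 n))) Qm p) : ℝ) : ℂ)) →
            ∀ (V : ℕ → ℝ → (Fin 4 → HubbardFieldIdx L M) → ℂ), (V = fun j t X => vertexFn L M β (gaussConv ℂ (softCovOf L M β μ (klFlowFrameU L M β U μ n) (softSymbolCompl L M β μ (klFlowFrameU L M β U μ n) (n + 1) j) + hubbardCovAboveCT L M β μ 0 (klFlowFrameU L M β U μ n) (klScale klE0 (n + 1)) - hubbardCovAboveCT L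
                M β μ 0 (klFlowFrameU L M β U μ n) (klScale klE0 n + t * (klScale klE0 (n + 1) - klScale klE0 n))) (hubbardEffectiveActionCT L M β U μ 0 (klFlowFrameU L M β U μ n) (klScale klE0 n + t * (klScale klE0 (n + 1) - klScale klE0 n)))) 4 X) →
            ∀ (V6 : ℕ → ℝ → (Fin 6 → HubbardFieldIdx L M) → ℂ), (V6 = fun j t X => vertexFn L M β (gaussConv ℂ (softCovOf L M β μ (klFlowFrameU L M β U μ n) (softSymbolCompl L M β μ (klFlowFrameU L M β U μ n) (n + 1) j) + hubbardCovAboveCT L M β μ 0 (klFlowFrameU L M β U μ n) (klScale klE0 (n + 1)) - hubbardCovAboveCT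
                L M β μ 0 (klFlowFrameU L M β U μ n) (klScale klE0 n + t * (klScale klE0 (n + 1) - klScale klE0 n))) (hubbardEffectiveActionCT L M β U μ 0 (klFlowFrameU L M β U μ n) (klScale klE0 n + t * (klScale klE0 (n + 1) - klScale klE0 n)))) 6 X) →
            ∀ (Sg : ℕ → ℝ → FreqMomentum L M → Fin 2 → ℂ), (Sg = fun j t p σ => selfEnergy L M β (gaussConv ℂ (softCovOf L M β μ (klFlowFrameU L M β U μ n) (softSymbolCompl L M β μ (klFlowFrameU L M β U μ n) (n + 1) j) + hubbardCovAboveCT L M β μ 0 (klFlowFrameU L M β U μ n) (klScale klE0 (n + 1)) - hubbardCovAboveCT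
                L M β μ 0 (klFlowFrameU L M β U μ n) (klScale klE0 n + t * (klScale klE0 (n + 1) - klScale klE0 n))) (hubbardEffectiveActionCT L M β U μ 0 (klFlowFrameU L M β U μ n) (klScale klE0 n + t * (klScale klE0 (n + 1) - klScale klE0 n)))) p σ) →
            ∀ (Hd : ℕ → ℝ → (Fin 4 → HubbardFieldIdx L M) → ℂ), (Hd = fun j t X => vertexFn L M β (dblFold ℂ (grassmannLaplacian ℂ (crossCov ℂ (Matrix.of fun X Y : HubbardFieldIdx L M => deriv (fun Λ' : ℝ => hubbardCovAboveCT L M β μ 0 (klFlowFrameU L M β U μ n) Λ' X Y) (klScale klE0 n + t * (klScale klE0 (n + 1) -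
                klScale klE0 n)))) ((gaussConv ℂ (crossCov ℂ (softCovOf L M β μ (klFlowFrameU L M β U μ n) (softSymbolCompl L M β μ (klFlowFrameU L M β U μ n) (n + 1) j) + hubbardCovAboveCT L M β μ 0 (klFlowFrameU L M β U μ n) (klScale klE0 (n + 1)) - hubbardCovAboveCT L M β μ 0 (klFlowFrameU L M β U μ n) (klScale
                klE0 n + t * (klScale klE0 (n + 1) - klScale klE0 n)))) - grassmannLaplacian ℂ (crossCov ℂ (softCovOf L M β μ (klFlowFrameU L M β U μ n) (softSymbolCompl L M β μ (klFlowFrameU L M β U μ n) (n + 1) j) + hubbardCovAboveCT L M β μ 0 (klFlowFrameU L M β U μ n) (klScale klE0 (n + 1)) - hubbardCovAboveCT L M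
                β μ 0 (klFlowFrameU L M β U μ n) (klScale klE0 n + t * (klScale klE0 (n + 1) - klScale klE0 n))))) (dblCopy ℂ 0 (gaussConv ℂ (softCovOf L M β μ (klFlowFrameU L M β U μ n) (softSymbolCompl L M β μ (klFlowFrameU L M β U μ n) (n + 1) j) + hubbardCovAboveCT L M β μ 0 (klFlowFrameU L M β U μ n) (klScale
                klE0 (n + 1)) - hubbardCovAboveCT L M β μ 0 (klFlowFrameU L M β U μ n) (klScale klE0 n + t * (klScale klE0 (n + 1) - klScale klE0 n))) (hubbardEffectiveActionCT L M β U μ 0 (klFlowFrameU L M β U μ n) (klScale klE0 n + t * (klScale klE0 (n + 1) - klScale klE0 n)))) * dblCopy ℂ 1 (gaussConv ℂ (softCovOf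
                L M β μ (klFlowFrameU L M β U μ n) (softSymbolCompl L M β μ (klFlowFrameU L M β U μ n) (n + 1) j) + hubbardCovAboveCT L M β μ 0 (klFlowFrameU L M β U μ n) (klScale klE0 (n + 1)) - hubbardCovAboveCT L M β μ 0 (klFlowFrameU L M β U μ n) (klScale klE0 n + t * (klScale klE0 (n + 1) - klScale klE0 n)))
                (hubbardEffectiveActionCT L M β U μ 0 (klFlowFrameU L M β U μ n) (klScale klE0 n + t * (klScale klE0 (n + 1) - klScale klE0 n)))))))) 4 X) →
            ∀ (Φ : ℕ → ℝ → FreqMomentum L M → ℝ), (Φ = fun j t k => (softSymbolCompl L M β μ (klFlowFrameU L M β U μ n) (n + 1) j) k + (hubbardCutoffWeightCT L M β μ (klFlowFrameU L M β U μ n) (klScale klE0 (n + 1)) k - hubbardCutoffWeightCT L M β μ (klFlowFrameU L M β U μ n) (klScale klE0 n + t * (klScale klE0 (n +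
                1) - klScale klE0 n)) k)) →
            ∀ (Wd : ℝ → FreqMomentum L M → ℝ), (Wd = fun t k => deriv (fun Λ' : ℝ => hubbardCutoffWeightCT L M β μ (klFlowFrameU L M β U μ n) Λ' k) (klScale klE0 n + t * (klScale klE0 (n + 1) - klScale klE0 n))) →
            ∀ (Br : ℕ → TorusSite 2 L → ℝ → TorusSite 2 L × MatsubaraIdx M → ℂ), (Br = fun j Qm t z => -(((((β * (L : ℝ) ^ 2 : ℝ) : ℂ)))⁻¹ * propCT L M β μ (klFlowFrameU L M β U μ n) (z.2, z.1) * propCT L M β μ (klFlowFrameU L M β U μ n) (z.2.rev, Qm - z.1)) * ((((klScale klE0 (n + 1) - klScale klE0 n) * (-Wd t (z.2,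
                z.1) * Φ j t (z.2.rev, Qm - z.1) - Φ j t (z.2, z.1) * Wd t (z.2.rev, Qm - z.1))) : ℝ) : ℂ)) →
            ∃ (c₄ RH RL : ℝ) (c₀ : ℂ) (F₁ : ℝ → FreqMomentum L M → Fin 2 → FreqMomentum L M → ℂ) (Nw : ℕ) (F₂ : Fin Nw → ℝ → FreqMomentum L M → Fin 2 → FreqMomentum L M → ℂ) (F₁₀ : ℝ → TorusSite 2 L → Fin 2 → TorusSite 2 L → ℂ) (Fx₁ : ℝ → FreqMomentum L M → FreqMomentum L M → ℂ) (Fx₂ : Fin Nw → ℝ → FreqMomentum L M → FreqMomentum L M → ℂ) (Fx₁₀ : ℝ → TorusSite 2 L → TorusSite 2 L → ℂ) (A₁ Kg ε₁ : ℝ) (Nc : ℕ) (S : Fin Nc → Finset (TorusSite 2 L)) (αc βc Lc : Fin Nc → ℝ) (r : ℝ) (cen cenx : Fin Nw → TorusSite 2 L) (ρw A₂ : Fin Nw → ℝ) (A₀S LAS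
                εS : ℝ),
              (∀ Λ ∈ Icc (klScale klE0 (n + 1)) (klScale klE0 n), hubbardEffPartitionFnCT L M β U μ 0 (klFlowFrameU L M β U μ n) Λ ≠ 0) ∧
              (∀ t ∈ Icc (0 : ℝ) 1, ∀ X, ‖V j t X‖ ≤ c₄ * U) ∧
              c₄ ^ 2 ≤ 2 ^ 3 * P.Klam ^ 2 ∧
              (∀ t ∈ Icc (0 : ℝ) 1, ‖Hd j t ![(((omega0 M, y), 0), 0), ((((omega0 M).rev, Qm - y), 1), 0), ((((omega0 M).rev, Qm - x), 1), 1), (((omega0 M, x), 0), 1)]‖ ≤ RH) ∧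
              (∀ t ∈ Icc (0 : ℝ) 1, ‖∑ z : TorusSite 2 L × MatsubaraIdx M, Br j Qm t z * ((if z.1 ∈ klBall L μ 0 then V j t ![(((omega0 M, z.1), 0), 0), ((((omega0 M).rev, Qm - z.1), 1), 0), ((((omega0 M).rev, Qm - x), 1), 1), (((omega0 M, x), 0), 1)] * V j t ![(((omega0 M, y), 0), 0), ((((omega0 M).rev, Qm - y), 1),
                  0), ((((omega0 M).rev, Qm - z.1), 1), 1), (((omega0 M, z.1), 0), 1)] else 0) - V j t ![(((z.2, z.1), 0), 0), (((z.2.rev, Qm - z.1), 1), 0), ((((omega0 M).rev, Qm - x), 1), 1), (((omega0 M, x), 0), 1)] * V j t ![(((omega0 M, y), 0), 0), ((((omega0 M).rev, Qm - y), 1), 0), (((z.2.rev, Qm - z.1), 1),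
                  1), (((z.2, z.1), 0), 1)])‖ ≤ RL) ∧
              (∀ t ∈ Icc (0 : ℝ) 1, ∀ (p : FreqMomentum L M) (σ : Fin 2) (p' : FreqMomentum L M), V j t ![((p, σ), 1), ((p', σ), 0), (((omega0 M, y), 0), 0), (((omega0 M, x), 0), 1)] * V j t ![((p, σ), 0), ((p', σ), 1), ((((omega0 M).rev, Qm - y), 1), 0), ((((omega0 M).rev, Qm - x), 1), 1)] = c₀ + F₁ t p σ p' + ∑ w, F₂ w t p
                  σ p') ∧
              (∀ t ∈ Icc (0 : ℝ) 1, ∀ (p p' : FreqMomentum L M), V j t ![((p, 0), 1), ((p', 1), 0), (((omega0 M, y), 0), 0), ((((omega0 M).rev, Qm - x), 1), 1)] * V j t ![((p, 0), 0), ((p', 1), 1), ((((omega0 M).rev, Qm - y), 1), 0), (((omega0 M, x), 0), 1)] = c₀ + Fx₁ t p p' + ∑ w, Fx₂ w t p p') ∧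
              (0 ≤ A₁) ∧
              (0 ≤ Kg) ∧
              (0 ≤ ε₁) ∧
              (∀ t ∈ Icc (0 : ℝ) 1, ∀ k : TorusSite 2 L, ‖∑ σ : Fin 2, F₁₀ t k σ (k + (x - y))‖ ≤ A₁) ∧
              (∀ t ∈ Icc (0 : ℝ) 1, ∀ k k' : TorusSite 2 L, ‖(∑ σ : Fin 2, F₁₀ t k σ (k + (x - y))) - ∑ σ : Fin 2, F₁₀ t k' σ (k' + (x - y))‖ ≤ Kg * klTorusNorm L (k - k')) ∧
              (∀ t ∈ Icc (0 : ℝ) 1, ∀ k : TorusSite 2 L, ‖∑ σ : Fin 2, F₁₀ t (k + -(x - y)) σ k‖ ≤ A₁) ∧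
              (∀ t ∈ Icc (0 : ℝ) 1, ∀ k k' : TorusSite 2 L, ‖(∑ σ : Fin 2, F₁₀ t (k + -(x - y)) σ k) - ∑ σ : Fin 2, F₁₀ t (k' + -(x - y)) σ k'‖ ≤ Kg * klTorusNorm L (k - k')) ∧
              (∀ t ∈ Icc (0 : ℝ) 1, ∀ (i : MatsubaraIdx M) (σ : Fin 2) (k k' : TorusSite 2 L), matsubaraFreq β M i ^ 2 ≤ (4 * klScale klE0 (n + 1)) ^ 2 → ‖F₁ t (i, k) σ (i, k') - F₁₀ t k σ k'‖ ≤ ε₁) ∧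
              (∀ t ∈ Icc (0 : ℝ) 1, ∀ k : TorusSite 2 L, ‖Fx₁₀ t k (k + (Qm - x - y))‖ ≤ A₁) ∧
              (∀ t ∈ Icc (0 : ℝ) 1, ∀ k k' : TorusSite 2 L, ‖Fx₁₀ t k (k + (Qm - x - y)) - Fx₁₀ t k' (k' + (Qm - x - y))‖ ≤ Kg * klTorusNorm L (k - k')) ∧
              (∀ t ∈ Icc (0 : ℝ) 1, ∀ k : TorusSite 2 L, ‖Fx₁₀ t (k + -(Qm - x - y)) k‖ ≤ A₁) ∧
              (∀ t ∈ Icc (0 : ℝ) 1, ∀ k k' : TorusSite 2 L, ‖Fx₁₀ t (k + -(Qm - x - y)) k - Fx₁₀ t (k' + -(Qm - x - y)) k'‖ ≤ Kg * klTorusNorm L (k - k')) ∧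
              (∀ t ∈ Icc (0 : ℝ) 1, ∀ (i i' : MatsubaraIdx M) (k k' : TorusSite 2 L), matsubaraInt M i' + 1 = matsubaraInt M i → matsubaraFreq β M i ^ 2 ≤ (5 * klScale klE0 (n + 1)) ^ 2 → ‖Fx₁ t (i, k) (i', k') - Fx₁₀ t k k'‖ ≤ ε₁) ∧
              (∀ i, αc i ≤ βc i) ∧
              (∀ i, 0 ≤ Lc i) ∧
              (100 / 7 * klScale klE0 (n + 1) + Real.pi / L ≤ r) ∧
              (∀ i, ∀ θ ∈ Icc (αc i) (βc i), ∀ k : TorusSite 2 L, torusSupNorm (klpeP L k - (perturbedFermiRadius (fun k : Fin 2 → ℝ => frameShift (klFlowFrameU L M β U μ n) (WithLp.toLp 2 k)) μ θ * Real.cos θ, perturbedFermiRadius (fun k : Fin 2 → ℝ => frameShift (klFlowFrameU L M β U μ n) (WithLp.toLp 2 k)) μ θ * Real.sin θ)) ≤ r → k ∈ S i) ∧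
              (∀ θ ∈ Ioo (-π) π, ∃ i, θ ∈ Icc (αc i) (βc i)) ∧
              (∀ t ∈ Icc (0 : ℝ) 1, ∀ i, ∀ k ∈ S i, ∀ k' ∈ S i, ‖(∑ σ : Fin 2, F₁₀ t k σ (k + (x - y))) - ∑ σ : Fin 2, F₁₀ t k' σ (k' + (x - y))‖ ≤ Lc i * klTorusNorm L (k - k')) ∧
              (∀ t ∈ Icc (0 : ℝ) 1, ∀ i, ∀ k ∈ S i, ∀ k' ∈ S i, ‖(∑ σ : Fin 2, F₁₀ t (k + -(x - y)) σ k) - ∑ σ : Fin 2, F₁₀ t (k' + -(x - y)) σ k'‖ ≤ Lc i * klTorusNorm L (k - k')) ∧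
              (∀ t ∈ Icc (0 : ℝ) 1, ∀ i, ∀ k ∈ S i, ∀ k' ∈ S i, ‖Fx₁₀ t k (k + (Qm - x - y)) - Fx₁₀ t k' (k' + (Qm - x - y))‖ ≤ Lc i * klTorusNorm L (k - k')) ∧
              (∀ t ∈ Icc (0 : ℝ) 1, ∀ i, ∀ k ∈ S i, ∀ k' ∈ S i, ‖Fx₁₀ t (k + -(Qm - x - y)) k - Fx₁₀ t (k' + -(Qm - x - y)) k'‖ ≤ Lc i * klTorusNorm L (k - k')) ∧
              (∀ w, 0 ≤ ρw w) ∧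
              (∀ w, 0 ≤ A₂ w) ∧
              (∀ t ∈ Icc (0 : ℝ) 1, ∀ w (p : FreqMomentum L M) (σ : Fin 2) (p' : FreqMomentum L M), ‖F₂ w t p σ p'‖ ≤ A₂ w) ∧
              (∀ t ∈ Icc (0 : ℝ) 1, ∀ w (p : FreqMomentum L M) (σ : Fin 2) (p' : FreqMomentum L M), ρw w < klTorusNorm L (p.2 - cen w) → F₂ w t p σ p' = 0) ∧
              (∀ t ∈ Icc (0 : ℝ) 1, ∀ w (p p' : FreqMomentum L M), ‖Fx₂ w t p p'‖ ≤ A₂ w) ∧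
              (∀ t ∈ Icc (0 : ℝ) 1, ∀ w (p p' : FreqMomentum L M), ρw w < klTorusNorm L (p.2 - cenx w) → Fx₂ w t p p' = 0) ∧
              (0 ≤ A₀S) ∧
              (0 ≤ LAS) ∧
              (0 ≤ εS) ∧
              (∀ t ∈ Icc (0 : ℝ) 1, ∀ k : TorusSite 2 L, ‖∑ σ : Fin 2, V6 j t ![(((omega0 M, k), σ), 0), (((omega0 M, k), σ), 1), (((omega0 M, y), 0), 0), ((((omega0 M).rev, Qm - y), 1), 0), ((((omega0 M).rev, Qm - x), 1), 1), (((omega0 M, x), 0), 1)] * Sg j t (omega0 M, k) σ‖ ≤ A₀S) ∧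
              (∀ t ∈ Icc (0 : ℝ) 1, ∀ k k' : TorusSite 2 L, ‖(∑ σ : Fin 2, V6 j t ![(((omega0 M, k), σ), 0), (((omega0 M, k), σ), 1), (((omega0 M, y), 0), 0), ((((omega0 M).rev, Qm - y), 1), 0), ((((omega0 M).rev, Qm - x), 1), 1), (((omega0 M, x), 0), 1)] * Sg j t (omega0 M, k) σ) - ∑ σ : Fin 2, V6 j t ![(((omega0 M,
                  k'), σ), 0), (((omega0 M, k'), σ), 1), (((omega0 M, y), 0), 0), ((((omega0 M).rev, Qm - y), 1), 0), ((((omega0 M).rev, Qm - x), 1), 1), (((omega0 M, x), 0), 1)] * Sg j t (omega0 M, k') σ‖ ≤ LAS * klTorusNorm L (k - k')) ∧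
              (∀ t ∈ Icc (0 : ℝ) 1, ∀ (i : MatsubaraIdx M) (σ : Fin 2) (k : TorusSite 2 L), matsubaraFreq β M i ^ 2 ≤ (4 * klScale klE0 (n + 1)) ^ 2 → ‖V6 j t ![(((i, k), σ), 0), (((i, k), σ), 1), (((omega0 M, y), 0), 0), ((((omega0 M).rev, Qm - y), 1), 0), ((((omega0 M).rev, Qm - x), 1), 1), (((omega0 M, x), 0), 1)]
                  * Sg j t (i, k) σ - V6 j t ![(((omega0 M, k), σ), 0), (((omega0 M, k), σ), 1), (((omega0 M, y), 0), 0), ((((omega0 M).rev, Qm - y), 1), 0), ((((omega0 M).rev, Qm - x), 1), 1), (((omega0 M, x), 0), 1)] * Sg j t (omega0 M, k) σ‖ ≤ εS) ∧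
              (2 * ‖c₀‖ + A₁ ≤ 2 ^ 10 * (P.Klam * U) ^ 2) ∧
              ((∑ i, Lc i * (βc i - αc i)) ≤ 2 ^ 35 * (P.Klam * U) ^ 2) ∧
              ((β ^ 2 + 1) * (2 ^ 18 * (Kg + LAS / 2) + 2 ^ 30 * ((2 * ‖c₀‖ + A₁) + A₀S / 2) * (4 + 8 / 3 * R.Gfr 1 * U ^ 2) * (16 : ℝ) ^ (j - (n + 1))) ≤ 4⁻¹ * (klEngQ9dG klEngGeo14 P R).CL β n) ∧
              (A₀S ≤ 2 ^ 24 * (P.Klam * U) ^ 3) ∧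
              (LAS ≤ 2 ^ 24 * (P.Klam * U) ^ 3) ∧
              ((klScale klE0 n - klScale klE0 (n + 1)) * (2⁻¹ * RH) ≤ 4⁻¹ * (klEngGeo11.cloc * (P.Klam * U) ^ 2 * (4 : ℝ) ^ (-(klEngGeo11.θ * n)))) ∧
              (RL + 2 * (3 / π * (128 / Real.pi * 8 * (Real.pi * Real.sqrt 2 / (cDtmin (-(6 / 5)) (-(1 / 10)) - 4 * (2 * R.Gfr 0 * |U| + 2 * R.Gfr 1 * U ^ 2 + R.Gfr 2 * (c / Real.log 4)))) * ((∑ i, (2 * Lc i + 4 * Kg) * (Real.pi / L) * (βc i - αc i)) / (2 * π)))) ≤ 4⁻¹ * ((klEngQ9dG klEngGeo14 P R).CL β n / L)) ∧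
              (2 * (ε₁ * (2048 * 15367) + ∑ w, A₂ w * (4096 * 15381) * (ρw w / π + ((L : ℝ))⁻¹)) + 2 * (εS * (2048 * 15367)) ≤ 4⁻¹ * (klEngGeo11.cloc * (P.Klam * U) ^ 2 * (4 : ℝ) ^ (-(klEngGeo11.θ * n))) + 4⁻¹ * ((klEngQ9dG klEngGeo14 P R).CR * (P.Klam * |U|) ^ 3 * ((2 : ℝ) ^ n)⁻¹)) ∧
              (¬ IsPairClassAt L Qm n → ∃ N : Matrix (TorusSite 2 L) (TorusSite 2 L) ℂ, (1 - diagonal (fun p => ((klTransferWeight L M β μ (klFlowFrameU L M β U μ n) n (softSymbolCompl L M β μ (klFlowFrameU L M β U μ n) n (n + 1)) Qm p - klTransferWeight L M β μ (klFlowFrameU L M β U μ n) n (softSymbolCompl L M β μ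
                  (klFlowFrameU L M β U μ n) n n) Qm p : ℝ) : ℂ)) * klMemberArrayF L M β U μ n (softSymbolCompl L M β μ (klFlowFrameU L M β U μ n) n n) Qm) * N = 1 ∧ N * (1 - diagonal (fun p => ((klTransferWeight L M β μ (klFlowFrameU L M β U μ n) n (softSymbolCompl L M β μ (klFlowFrameU L M β U μ n) n (n + 1)) Qm p -
                  klTransferWeight L M β μ (klFlowFrameU L M β U μ n) n (softSymbolCompl L M β μ (klFlowFrameU L M β U μ n) n n) Qm p : ℝ) : ℂ)) * klMemberArrayF L M β U μ n (softSymbolCompl L M β μ (klFlowFrameU L M β U μ n) n n) Qm) = 1 ∧ ∀ k ∈ klBall L μ 0, ∀ k' ∈ klBall L μ 0, ‖klMemberArrayF L M β U μ n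
                  (softSymbolCompl L M β μ (klFlowFrameU L M β U μ n) n (n + 1)) Qm k k' - (klMemberArrayF L M β U μ n (softSymbolCompl L M β μ (klFlowFrameU L M β U μ n) n n) Qm * N) k k'‖ ≤ (transferBarRelIdx L klEngGeoTh P (klCT8 P R (klEngQ7 P R) klEngGeo14 klEngGeoTh) β U n n) Qm k k') ∧
              ((n + 1 ≤ nScales β → ∀ (s₀ s₁ : FreqMomentum L M × Fin 2 → ℂ), (s₀ = uvSymbolCT L M β μ (klFlowFrameU L M β U μ n) (klScale klE0 (n + 1))) → (s₁ = fun ks => uvSymbolCT L M β μ (klFlowFrameU L M β U μ (n + 1)) (klScale klE0 (n + 1)) ks / (1 + uvSymbolCT L M β μ (klFlowFrameU L M β U μ (n + 1)) (klScale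
                  klE0 (n + 1)) ks * (((fsub (klFlowFrameU L M β U μ (n + 1)) (klFlowFrameU L M β U μ n)).eval (latticeMomentum L ks.1.2) / (β * (L : ℝ) ^ 2) : ℝ) : ℂ))) → ∃ (a n₆ s₂ n₄ : ℝ), (effPartitionFn ℂ (normalCovariance L M (uvSymbolCT L M β μ (klFlowFrameU L M β U μ (n + 1)) (klScale klE0 (n + 1))))
                  (hubbardInteraction L M β U + counterQuadratic L M β (klFlowFrameU L M β U μ (n + 1))) ≠ 0) ∧ (∀ t ∈ Set.Icc (0 : ℝ) 1, effPartitionFn ℂ (normalCovariance L M s₀ + ((t : ℂ)) • (normalCovariance L M s₁ - normalCovariance L M s₀)) (hubbardInteraction L M β U + counterQuadratic L M β (klFlowFrameU L M β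
                  U μ n)) ≠ 0) ∧ 0 ≤ a ∧ a ≤ 2 ^ 28 ∧ 0 ≤ n₆ ∧ 0 ≤ s₂ ∧ 0 ≤ n₄ ∧ (547400 * (8 / Real.pi * 2946 * n₆ + 4 * s₂ * n₄) ≤ klHshiftC) ∧ (‖klPairAmplitude L M β U μ (klFlowFrameU L M β U μ (n + 1)) (n + 1) Qm x y‖ ≤ a * (P.Klam * |U|)) ∧ (∀ t ∈ Set.Icc (0 : ℝ) 1, ∀ A : HubbardFieldIdx L M, ‖kernel ℂ
                  (effAction ℂ (normalCovariance L M s₀ + ((t : ℂ)) • (normalCovariance L M s₁ - normalCovariance L M s₀)) (hubbardInteraction L M β U + counterQuadratic L M β (klFlowFrameU L M β U μ n))) 6 (Fin.snoc (Fin.snoc ![(((omega0 M, y), 0), 0), ((((omega0 M).rev, Qm - y), 1), 0), ((((omega0 M).rev, Qm - x),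
                  1), 1), (((omega0 M, x), 0), 1)] (A.1, 1 - A.2) : Fin 5 → HubbardFieldIdx L M) A)‖ ≤ n₆ * (P.Klam * U) ^ 2 / klScale klE0 (n + 1) / (720 * (β * (L : ℝ) ^ 2) ^ 5)) ∧ (∀ t ∈ Set.Icc (0 : ℝ) 1, ∀ i : Fin 4, |nambuXiCT L μ (klFlowFrameU L M β U μ n) ((![(((omega0 M, y), 0), 0), ((((omega0 M).rev, Qm -
                  y), 1), 0), ((((omega0 M).rev, Qm - x), 1), 1), (((omega0 M, x), 0), 1)] : Fin 4 → HubbardFieldIdx L M) i).1.1.2| < 5 * klScale klE0 (n + 1) / 4 → ‖kernel ℂ (effAction ℂ (normalCovariance L M s₀ + ((t : ℂ)) • (normalCovariance L M s₁ - normalCovariance L M s₀)) (hubbardInteraction L M β U +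
                  counterQuadratic L M β (klFlowFrameU L M β U μ n))) 2 ![((((![(((omega0 M, y), 0), 0), ((((omega0 M).rev, Qm - y), 1), 0), ((((omega0 M).rev, Qm - x), 1), 1), (((omega0 M, x), 0), 1)] : Fin 4 → HubbardFieldIdx L M) i).1, 1 - ((![(((omega0 M, y), 0), 0), ((((omega0 M).rev, Qm - y), 1), 0), ((((omega0
                  M).rev, Qm - x), 1), 1), (((omega0 M, x), 0), 1)] : Fin 4 → HubbardFieldIdx L M) i).2) : HubbardFieldIdx L M), (![(((omega0 M, y), 0), 0), ((((omega0 M).rev, Qm - y), 1), 0), ((((omega0 M).rev, Qm - x), 1), 1), (((omega0 M, x), 0), 1)] : Fin 4 → HubbardFieldIdx L M) i]‖ ≤ s₂ * |U| * klScale klE0 (n +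
                  1) / (2 * (β * (L : ℝ) ^ 2))) ∧ (∀ t ∈ Set.Icc (0 : ℝ) 1, ‖kernel ℂ (effAction ℂ (normalCovariance L M s₀ + ((t : ℂ)) • (normalCovariance L M s₁ - normalCovariance L M s₀)) (hubbardInteraction L M β U + counterQuadratic L M β (klFlowFrameU L M β U μ n))) 4 ![(((omega0 M, y), 0), 0), ((((omega0
                  M).rev, Qm - y), 1), 0), ((((omega0 M).rev, Qm - x), 1), 1), (((omega0 M, x), 0), 1)]‖ ≤ n₄ * (P.Klam * |U|) / (24 * (β * (L : ℝ) ^ 2) ^ 3))) ∧ (n = nScales β → ∃ a : ℝ, (IsUnit (effPartitionFn ℂ (normalCovariance L M (uvSymbolCT L M β μ (klFlowFrameU L M β U μ (n + 1)) (klScale klE0 (n + 1))))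
                  (hubbardInteraction L M β U + counterQuadratic L M β (klFlowFrameU L M β U μ (n + 1))))) ∧ 0 ≤ a ∧ a ≤ 2 ^ 28 ∧ (‖klPairAmplitude L M β U μ (klFlowFrameU L M β U μ (n + 1)) (n + 1) Qm x y‖ ≤ a * (P.Klam * |U|))))) :
    ∀ (P : SplitConsts) (R : RenConsts) (c : ℝ), P.WF → R.WF2 → 0 < c → c ≤ klEngC₃7GU klEngGeo14 P R →
      ∀ μ ∈ klWindowC, ∀ U : ℝ, 0 < U → U ≤ klEngU₀12GQ klEngGeo14 (klEngQ9dG klEngGeo14 P R) P R c → ∀ β : ℝ, klBetaMin ≤ β → β ≤ Real.exp (c / U ^ 2) →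
        ∀ (L M : ℕ) [NeZero L] [NeZero M], klEngL₄ P R β U ≤ L → klEngM₃ β U L ≤ M →
          ∀ n : ℕ, 1 ≤ n → n ≤ nScales β + 1 → IsKLRegime U c (-(n : ℤ)) →
            HistP klPredsV17F2 L M klEngGeo14 P (klEngQ9dG klEngGeo14 P R) R β U μ 0 n →
              FrameOK R U (nScales β) μ (klFlowFrameU L M β U μ n) →
                KernelNormsV4 L M P (klEngQ9dG klEngGeo14 P R) β U μ (klFlowFrameU L M β U μ n) n →
                  (∀ j ≤ n, (KernelNormsLevels L M P (klEngQ9dG klEngGeo14 P R) β U μ (klFlowFrameU L M β U μ n) j ∧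
                    KernelNormsWt4 L M (klWtBudget P (klEngQ9dG klEngGeo14 P R) U j) β U μ (klFlowFrameU L M β U μ n) j)) →
                    (∀ j ≤ n, LevelsUExportMixedAt L M (klCU2 P R (klEngQ7 P R)) P β U μ j) →
                      (∀ j ≤ n, IsoTupleLineBAt L M klE5AM klE5cM (klE5dM P R) P β U μ j) →
                        (∀ j ≤ n, PairTransferRelFamilyK5 L M klEngGeoTh P (klCT8 P R (klEngQ7 P R) klEngGeo14 klEngGeoTh) β U μ j) →
        ∀ Qm : TorusSite 2 L, ¬ IsPairClassAt L Qm n → ∀ k ∈ klBall L μ 0, ∀ k' ∈ klBall L μ 0,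
          ‖klPairAmplitude L M β U μ (klFlowFrameU L M β U μ n) n Qm k k' -
              klPairAmplitude L M β U μ (klFlowFrameU L M β U μ (n - 1)) (n - 1) Qm k k'‖ ≤
            gainBar klEngGeo14 P U n (klTorusNorm L Qm) (klTorusNorm L (k - k')) (klTorusNorm L (k + k' - Qm)) +
              eremBar klEngGeo14 P (klEngQ9dG klEngGeo14 P R) U β L (n - 1) + thermalBar klEngGeo14 P U β n +
                legDressBarQ2 klEngGeo14 P (klEngQ9dG klEngGeo14 P R) U n
                  (legSliceCountT L β μ (klFlowFrameU L M β U μ n) n ![k', Qm - k', Qm - k, k]) +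
                  frameShiftBar P (klEngQ9dG klEngGeo14 P R) U n := by
  intro P R c hP hR hc hc3 μ hμ U hU hUle β hβ hβc L M _ _ hL hM n' hn1 hn' hreg hhist hfr hV4 hlev hlevU hiso htr Qm hQ x hx y hy
  obtain ⟨n, rfl⟩ : ∃ n, n' = n + 1 := ⟨n' - 1, by omega⟩
  have hpkg := hexOutPkg P R c hP hR hc hc3 μ hμ U hU hUle β hβ hβc L M hL hM (n + 1) hn1 hn' hreg hhist hfr hV4 hlev hlevU hiso htr n rfl Qm hQ x hx y hy
  clear hexOutPkg
  simp only [Nat.add_sub_cancel]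
  -- the doors (…ClosersVGQDoors)
  have hUu := rowC_hUu klEngGeo14 hUle
  have hGU := rowC_hGU klEngGeo14 hR hU hUle
  obtain ⟨hβL, hGL⟩ := rowC_hGL klEngGeo14 hR hU hUle hβ hL
  have hnβ : n ≤ nScales β := by omega
  have hK := rowC_frameOK_lower klEngGeo14 hR hμ hnβ hhist
  obtain ⟨hAb, hA, hA20, hμ15, hlo, hhi, hMc⟩ := rowC_frameWindow klEngGeo14 hR hc hc3 hμ hU hUle hβ hβc hM hK n
  obtain ⟨hKU0, hKU, -⟩ := rowC_klam_mul_le klEngGeo14 hP hU hUle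
  have hcU' := rowC_hcU' klEngGeo14 hP hU hUle
  have hQwf : (klEngQ9dG klEngGeo14 P R).WF := klEngQ9dG_wf klEngGeo14 P R
  have harr : PairArrayAtV17F L M P (klEngQ9dG klEngGeo14 P R) β U μ n :=
    (((histP_klPredsV17F2_iff L M klEngGeo14 P (klEngQ9dG klEngGeo14 P R) R β U μ 0 (n + 1)).1 hhist) n (Nat.lt_succ_self n)).1.1
  obtain ⟨m', hm', hm'K, hA'⟩ := rowC_pairArray_apriori hP hQwf.2.1 hcU' harr Qm
  have hsm := rowC_hsm (P := P) hK hβ hβL hm'K hKU0 hKU Qm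
  have hsoft := fun k => softSymbolCompl_succ_soft (L := L) (M := M) β μ (klFlowFrameU L M β U μ n) n k
  have hE := rowC_hE_klEngGeo14 (β := β) hP hU hUle L n
  have hKlam : 0 ≤ P.Klam := zero_le_one.trans hP.1
  have hTb : transferBarRelIdx L klEngGeoTh P (klCT8 P R (klEngQ7 P R) klEngGeo14 klEngGeoTh) β U n n Qm x y ≤
      (2 : ℝ)⁻¹ ^ 15 * ((P.Klam * U) ^ 2 * (klEngGeo14.phGain (n + 1) (klTorusNorm L (x - y)) + klEngGeo14.phGain (n + 1) (klTorusNorm L (x + y - Qm)))) +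
        (2 * klCT8 P R (klEngQ7 P R) klEngGeo14 klEngGeoTh * 15367 * ((P.Klam * U) ^ 2 * ((L : ℝ))⁻¹) +
          4 * klCT8 P R (klEngQ7 P R) klEngGeo14 klEngGeoTh * 15367 * ((P.Klam * |U|) ^ 3 * ((2 : ℝ) ^ (n + 1))⁻¹)) +
        (2 : ℝ)⁻¹ ^ 5 * thermalBar klEngGeo14 P U β (n + 1) :=
    (transferBarRelIdx_klCT8_le_slots_klEngGeo14 (L := L) (β := β) (U := U) (n := n) hKlam R (klEngQ7 P R) klEngGeo14 Qm x y).trans_eq (by ring)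
  -- the package
  obtain ⟨c₄, RH, RL, c₀, F₁, Nw, F₂, F₁₀, Fx₁, Fx₂, Fx₁₀, A₁, Kg, ε₁, Nc, S, αc, βc, Lc, r, cen, cenx, ρw, A₂, A₀S, LAS, εS, hZ, hrow, ha₀, hH, hLr, hsplit, hsplitX,
      hA1, hKg, hε1, hY0p₁, hY1p₁, hY0m₁, hY1m₁, hflat₁, hY0B₁, hY1B₁, hY0A₁, hY1A₁, hflatX₁, hαβ, hLc, hr, hserve, hcover, hcellp, hcellm, hcellB, hcellA,
      hρw, hA2, hF₂, hsupp₂, hFx₂, hsuppx₂, hA0S, hLAS, hεS, hY0S, hY1S, hflatS,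
      hcA0, hcI1, hShareLat, hcA0S, hcLAS, hShareHd, hShareRL, hShareEps, hrawβ, ⟨hshA, hshB⟩⟩ :=
    hpkg (n + 1) rfl _ _ _ rfl rfl rfl _ rfl _ rfl _ rfl _ rfl _ rfl _ rfl _ rfl
  clear hpkg
  -- the size rows from the currency rows (…ClosersVGQSizeFits / …SizeFitsC)
  have hI10 : 0 ≤ ∑ i, Lc i * (βc i - αc i) := Finset.sum_nonneg fun i _ => mul_nonneg (hLc i) (sub_nonneg.mpr (hαβ i))
  obtain ⟨hTHS, hZS, hTH, hTHR, hTR, hShareBorn, hD⟩ :=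
    rowC_sizeFitsC_klEng14Q9dG_of_currency hP hR hc hU hUle hA20 n hA1 hI10 hA0S hLAS hcA0 hcI1 hcA0S hcLAS
  have hr' : 4 * klScale klE0 (n + 1) / (cDtmin (-(6 / 5)) (-(1 / 10)) - 4 * (2 * R.Gfr 0 * |U| + 2 * R.Gfr 1 * U ^ 2 + R.Gfr 2 * (c / Real.log 4))) + Real.pi / L ≤ r := by
    have hΛ := KLRegimeSplit.klth_klScale_pos (n + 1)
    have h1 : 4 * klScale klE0 (n + 1) / (cDtmin (-(6 / 5)) (-(1 / 10)) - 4 * (2 * R.Gfr 0 * |U| + 2 * R.Gfr 1 * U ^ 2 + R.Gfr 2 * (c / Real.log 4))) ≤ 100 / 7 * klScale klE0 (n + 1) := by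
      rw [div_le_iff₀ (lt_of_lt_of_le (by norm_num) hD)]; nlinarith
    linarith
  -- the frame-shift binder from p2's producers (`hshift_succ_of_sizes_geom` below the last index, `hshift_lastScale_succ_of_size` at it)
  have hβ0 : 0 < β := KLRegimeSplit.pos_of_klBetaMin_le hβ
  have hL3 : klEngL₃ β U ≤ L := klEngL₃_le_of_klEngL₄_le hL
  have hU4 : U ≤ klEngU₀4 P R c := hUle.trans (klEngU₀12GQ_le_klEngU₀4 klEngGeo14 _ P R c)
  have hQ8 : (klEngQ8 P R).IsRaiseOf (klEngQ9dG klEngGeo14 P R) := isRaiseOf_klEngQ9dG_klEngQ8 klEngGeo14 P R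
  have hshift : ‖klPairAmplitude L M β U μ (klFlowFrameU L M β U μ (n + 1)) (n + 1) Qm x y -
      klPairAmplitude L M β U μ (klFlowFrameU L M β U μ n) (n + 1) Qm x y‖ ≤ frameShiftBar P (klEngQ9dG klEngGeo14 P R) U (n + 1) := by
    rcases Nat.lt_or_ge n (nScales β) with hlt | hge
    · obtain ⟨a, n₆, s₂, n₄, hZ₂, hZ, ha0, ha, hn₆, hs₂, hn₄, hroom, hC4, hN6, hS, hN4⟩ := hshA (by omega) _ _ rfl rfl
      exact hshift_succ_of_sizes_geom hμ hL3 hβ (by omega) hhist hP hR.1 hQ8 hU hU4 hβ0 hZ₂ rfl rfl hZ ha0 ha hn₆ hs₂ hn₄ hroom hC4 hN6 hS hN4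
    · have hnn : n = nScales β := by omega
      obtain ⟨a, hZ₂, ha0, ha, hC4⟩ := hshB hnn
      subst hnn
      exact hshift_lastScale_succ_of_size hhist hP hR.1 hQ8 hU hU4 hβ0 hZ₂ ha0 ha hC4
  -- the a-priori blocks from the (N₄-PATH) row (p693922)
  obtain ⟨⟨⟨hm0, hm, hAm⟩, ⟨hM40, hM4, hM4K, hM4KG⟩⟩, -⟩ :=
    outClass_apriori_blocks_of_quarticPathRow L M β U μ hR hU (hUle.trans (klEngU₀12GQ_le_klEngU₀10 klEngGeo14 _ P R c)) _ rfl _ rfl (n + 1) Qm hrow ha₀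
  exact outClass_hout_klEngGeo14_of_shares_of_raw_cells L M β U μ
    (bandBounds (show (-4 : ℝ) < -(6 / 5) by norm_num) (show (-(6 / 5) : ℝ) ≤ -(1 / 10) by norm_num) (show (-(1 / 10) : ℝ) < 0 by norm_num))
    hR hU hUu hμ hβ hβL hnβ hK hGL hGU.2 hAb hA hA20 hμ15 hlo hhi hMc _ _ _ rfl rfl rfl _ rfl _ rfl _ rfl _ rfl _ rfl _ rfl _ rfl (n + 1) le_rfl hQ hZ
    hm0 hm hAm x y hM40 hM4 hM4K hM4KG hH hLr c₀ F₁ F₂ F₁₀ hsplit Fx₁ Fx₂ Fx₁₀ hsplitX hA1 hKg hε1 hY0p₁ hY1p₁ hY0m₁ hY1m₁ hαβ hLc hr' hserve hcover hcellp hcellm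
    hflat₁ hY0B₁ hY1B₁ hY0A₁ hY1A₁ hcellB hcellA hflatX₁
    cen cenx hρw hA2 hF₂ hsupp₂ hFx₂ hsuppx₂ hA0S hLAS hεS hY0S hY1S hflatS hTHS hZS hTH hTHR hTR (klEngQ9dG klEngGeo14 P R) hKlam hQwf.2.1 (s := 4⁻¹) (by norm_num)
    hShareHd hShareRL hShareLat hShareBorn hShareEps rfl hx hy
    (Tb := transferBarRelIdx L klEngGeoTh P (klCT8 P R (klEngQ7 P R) klEngGeo14 klEngGeoTh) β U n n)
    -- regime (α) (`Qm` in class at the LOWER scale `n`): the relative datum IS the stub's `htr` at `n` (pair `m := n+1`, `m′ := n`); regime (β): the package row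
    ((Classical.em (IsPairClassAt L Qm n)).elim (fun hQn => (htr n (Nat.le_succ n)) (n + 1) n le_rfl (Nat.le_succ n) hn' Qm hQn) fun hQn => hrawβ hQn)
    hm' hm'K hA' hsm hsoft hTb hE hshift

end Summit.HubbardSuperconductivity.HubbardSuperconductivity.Theorems.EngineV8

end
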